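/-
Copyright (c) 2026 the pub-hodgecm-mathlib formalisation cell (harness21).  Prover seat hodgecm-mathlib-B-p04 (g34) — EP PEN of (R2) (LEAD F0P3a-plan (g9)
WORD T8-167, desk F0P3-plan (g8) dedup 2026-09-01T08:07:50Z, token ruling 08:12:47Z), 2026-09-01.  FILE (R3c) of the Euler–Poincaré road for
`stub_N6nsR2EP : RankOneEulerPoincareNonsplit` (type (1) EDGE COUNT; the star counts are shared with B-p10 (g25)'s (ii) `𝟙_I` non-elliptic unfolding).
-/
import Literature.NumberTheory.Automorphic.UnitaryTwoResidualProjectiveLine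
import Literature.NumberTheory.Automorphic.FixedCosetsStableLattices
import Literature.NumberTheory.LocalFields.UnramifiedQuadraticNormQuadraticCount
import HarnessLib

/-!
# The Iwahori star of the unramified `U(1,1)`: fixed points of `k ∈ K = U(Φ₂)(𝒪)` on `K ⧸ I` by reduction type

Topic `NumberTheory/Automorphic`, namespace `Literature.NumberTheory.Automorphic`.  THEOREMS ONLY: no definition, no named fact, no instance, no
notation, no `sorry`; kernel lane.  FILE (R3c) of the EP road for `stub_N6nsR2EP : RankOneEulerPoincareNonsplit` (brick (2b/2c) of the census
`CENSUS-R2EP-RankOneEulerPoincare.B-p04g34.md`), on ★ (R3a) `UnitaryTwoIsotropicEigenLines` + ★ (R3b) `UnitaryTwoResidualProjectiveLine`.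

THE MATHEMATICS.  `F` a field with a `ValuativeRel`, `σ` an endomorphism of `F` restricting to an involution `σO` of `𝒪 = 𝒪[F]` that moves some
integer by a unit (`IsUnit (σO a₀ − a₀)`: the unramified situation) with reduction `τ` on `𝓀 = 𝓀[F]`; `Φ₂ = antidiag(1,1)`, `U = U(σ, Φ₂) ≤ GL₂(F)`,
`K = U ∩ GL₂(𝒪)` (hyperspecial: the stabiliser of the self-dual vertex `𝒪²` of the Bruhat–Tits tree of `U`), `I = U ∩ Iwahori` (the stabiliser of the
edge `{𝒪², ϖ⁻¹𝒪 ⊕ 𝒪}`).  The STAR `K ⧸ I` of the vertex is identified `K`-equivariantly, through the reduction `k ↦ k̄ ∈ GL₂(𝓀)`, with the ISOTROPIC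
points of `ℙ(𝓀²)`: `I = Stab ⟨ē₀⟩` (★ R3b) and the orbit of `⟨ē₀⟩` is all isotropic points (`exists_glIntReduction_smul_eq_of_isotropic`: `⟨(0,1)⟩ = w̄⟨ē₀⟩`
for `w = Φ₂ ∈ K`, `⟨(1,t)⟩ = v(s)‾⟨ē₀⟩` for the unitary unipotent `v(s) = [[1,0],[s,1]]`, `σ s = −s ≡ t` — antisymmetric residues LIFT to antisymmetric
integers, `exists_residue_eq_and_map_eq_neg`, [Serre1979, V §2]).  Hence (`natCard_fixedBy_unitaryTwo_star_eq`, on ★ `natCard_fixedBy_quotient_stabilizer_eq`)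
the `k`-fixed points of the star are the `k̄`-fixed isotropic points, counted in ★ (R3b) by the reduction type of `k̄ ∈ U(τ, Φ₂)(𝓀)`; for
`k = P diag(u₀,u₁) P⁻¹ ∈ K` with `uᵢ` integral of norm one (`trace_det_glIntReduction_of_eigenframe`: `tr k̄ = ū₀ + ū₁`, `det k̄ = ū₀ū₁`):
* `natCard_fixedBy_unitaryTwo_star_of_scalar` — `k ≡ a·1 (mod 𝓂)` ⇒ `#Fix = #{τ t = −t} + 1` (`= q + 1`, `natCard_antifixed_residueField_eq` on ★
  `natCard_antifixed_quotient_pow`; also `[K : I] = q + 1`, `natCard_unitaryTwo_star`);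
* `natCard_fixedBy_unitaryTwo_star_of_valuation_sub_lt_one` — `|u₀ − u₁| < 1`, `k ≢ u₁·1 (mod 𝓂)` ⇒ `#Fix = 1`;
* `natCard_fixedBy_unitaryTwo_star_of_valuation_sub_eq_one` — `|u₀ − u₁| = 1` ⇒ `#Fix = 0`.
These are the local fixed-edge multiplicities in Kottwitz's `O_γ(f_EP) = χ(X^γ)` on the tree of `U(1,1)` [Kottwitz1988, §2]; summed over the `γ`-fixed
self-dual vertices along ★ `natCard_fixedBy_quotient_eq_sum_of_le` they give the Iwahori edge count `E(γ)` of (R2) [Rogawski1990, §12.6–12.7].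
The `MulAction` instance of `K` on `K ⧸ I` is written explicitly (`MulAction.quotient`) in the statements: instance search through the tower
`K ≤ U ≤ GL₂(F) = M₂(F)ˣ` exceeds the default synthesis budget, while the explicit term is the one ★ `natCard_fixedBy_quotient_eq_sum_of_le` produces.
HONEST LABEL: HC_CM is proved only modulo the cell's remaining named inputs (hLiu418, h413) until rung 0 closes; this file is unconditional algebra.

## References
* [Kottwitz1988] R. E. Kottwitz, *Tamagawa numbers*, Ann. of Math. 127 (1988), 629–646, §2 (Euler–Poincaré functions; `O_γ(f_EP) = χ(X^γ)`).
* [Serre1980Trees] J.-P. Serre, *Trees* (1980), Ch. II §1.1 (the tree of `SL₂` over a local field; the star of a vertex = `ℙ¹` of the residue field).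
* [Rogawski1990] J. D. Rogawski, *Automorphic Representations of Unitary Groups in Three Variables* (1990), §12.6–12.7 pp. 174–176 (Lemma 12.7.1).
* [IwahoriMatsumoto1965] N. Iwahori, H. Matsumoto, Publ. Math. IHÉS 25 (1965), §2 (Iwahori subgroup = preimage of the Borel under reduction).
* [Serre1979] J.-P. Serre, *Local Fields*, GTM 67 (1979), Ch. V §2 Prop. 2–3 (unramified quadratic extensions: trace and fixed points).
-/

set_option autoImplicit false

open scoped ValuativeRel Matrix MatrixGroups
open Matrix ValuativeRel

namespace Literature.NumberTheory.Automorphic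

/-! ## §3 (continued) The orbit of `⟨ē₀⟩` under `K` is the set of isotropic points; eigenframes -/

section Valued

variable {F : Type*} [Field F] [ValuativeRel F] (σ : F →+* F) (σO : 𝒪[F] →+* 𝒪[F])
  (hσO' : ∀ x : 𝒪[F], ((σO x : 𝒪[F]) : F) = σ x) (τ : 𝓀[F] →+* 𝓀[F])
  (hτ : ∀ x : 𝒪[F], IsLocalRing.residue 𝒪[F] (σO x) = τ (IsLocalRing.residue 𝒪[F] x))

include hτ in
/-- **Antisymmetric residues lift to antisymmetric integers**: if `τ t = −t` then `t = s mod 𝓂` for some `s ∈ 𝒪` with `σ s = −s` (divide by the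
antisymmetric unit `σ a₀ − a₀`, lift the `τ`-FIXED class ★ `exists_fixed_sub_mem`, multiply back). [cite: Serre1979, Ch. V §2 Prop. 2] -/
theorem exists_residue_eq_and_map_eq_neg (hσσ : ∀ x, σO (σO x) = x) {a₀ : 𝒪[F]} (ha₀ : IsUnit (σO a₀ - a₀)) {t : 𝓀[F]} (ht : τ t = -t) :
    ∃ s : 𝒪[F], IsLocalRing.residue 𝒪[F] s = t ∧ σO s = -s := by
  have hσd : σO (σO a₀ - a₀) = -(σO a₀ - a₀) := by rw [map_sub, hσσ, neg_sub]
  have hσdi : σO (↑(ha₀.unit⁻¹) : 𝒪[F]) = -↑(ha₀.unit⁻¹) :=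
    LocalFields.UnramifiedQuadraticNorm.map_unit_inv_eq_neg σO hσσ ha₀
  obtain ⟨t₁, ht₁⟩ := IsLocalRing.residue_surjective t
  have hres_d : τ (IsLocalRing.residue 𝒪[F] (↑(ha₀.unit⁻¹) : 𝒪[F])) = -IsLocalRing.residue 𝒪[F] (↑(ha₀.unit⁻¹) : 𝒪[F]) := by
    rw [← hτ, hσdi, map_neg]
  have hy : σO (t₁ * ↑(ha₀.unit⁻¹)) - t₁ * ↑(ha₀.unit⁻¹) ∈ IsLocalRing.maximalIdeal 𝒪[F] := by
    rw [← IsLocalRing.residue_eq_zero_iff, map_sub, hτ, map_mul, map_mul, ht₁, ht, hres_d]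
    ring
  obtain ⟨r, hr, hry⟩ := LocalFields.UnramifiedQuadraticNorm.exists_fixed_sub_mem σO hσσ ha₀ hy
  have hry' : IsLocalRing.residue 𝒪[F] r = IsLocalRing.residue 𝒪[F] (t₁ * ↑(ha₀.unit⁻¹)) := by
    rw [← sub_eq_zero, ← map_sub, IsLocalRing.residue_eq_zero_iff]; exact hry
  refine ⟨r * (σO a₀ - a₀), ?_, ?_⟩
  · rw [map_mul, hry', map_mul, ht₁, mul_assoc, ← map_mul, IsUnit.val_inv_mul, map_one, mul_one]
  · rw [map_mul, hr, hσd, mul_neg]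

/-- The element `w = antidiag(1, 1)` of `GL₂(F)` (an involution). [cite: Rogawski1990, §12.6 p. 174] -/
theorem antidiagTwo_mul_antidiagTwo {R : Type*} [CommRing R] : (!![(0 : R), 1; 1, 0] : Matrix (Fin 2) (Fin 2) R) * !![(0 : R), 1; 1, 0] = 1 := by
  rw [Matrix.mul_fin_two, Matrix.one_fin_two]; simp

/-- The unipotent `v(s) = [[1, 0], [s, 1]]` has inverse `v(−s)`. [cite: Rogawski1990, §12.6 p. 174] -/
theorem lowerUnipotent_mul_neg {R : Type*} [CommRing R] (s : R) :
    (!![(1 : R), 0; s, 1] : Matrix (Fin 2) (Fin 2) R) * !![(1 : R), 0; -s, 1] = 1 ∧ (!![(1 : R), 0; -s, 1] : Matrix (Fin 2) (Fin 2) R) * !![(1 : R), 0; s, 1] = 1 := by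
  rw [Matrix.mul_fin_two, Matrix.mul_fin_two, Matrix.one_fin_two]; constructor <;> simp

include hσO' hτ in
/-- **Every isotropic point is in the orbit of `⟨ē₀⟩` under `K`**: `⟨(0,1)⟩ = w̄ ⟨ē₀⟩` for `w = antidiag(1,1) ∈ K`, and `⟨(1, t)⟩ = v(s)‾ ⟨ē₀⟩` for the
unitary integral unipotent `v(s) = [[1,0],[s,1]]`, `σ s = −s`, `s ≡ t` (★ `exists_residue_eq_and_map_eq_neg`).  [cite: Serre1980Trees, Ch. II §1.1]
[cite: Kottwitz1988, §2] -/
theorem exists_glIntReduction_smul_eq_of_isotropic (hσσ : ∀ x, σO (σO x) = x) {a₀ : 𝒪[F]} (ha₀ : IsUnit (σO a₀ - a₀))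
    {J : Matrix (Fin 2) (Fin 2) F} (hJ : J = !![0, 1; 1, 0]) (h10 : (![1, 0] : Fin 2 → 𝓀[F]) ≠ 0) (x : Projectivization 𝓀[F] (Fin 2 → 𝓀[F]))
    (hx : ((τ ∘ x.rep) ᵥ* !![(0 : 𝓀[F]), 1; 1, 0]) ⬝ᵥ x.rep = 0) :
    ∃ k : ↥((glInt 2 F).subgroupOf (unitaryGroupOfForm σ J)),
      (glIntReduction 2 F ⟨((k : ↥(unitaryGroupOfForm σ J)) : GL (Fin 2) F), k.2⟩ : GL (Fin 2) 𝓀[F]) • Projectivization.mk 𝓀[F] ![1, 0] h10 = x := by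
  subst hJ
  have h01 : (![0, 1] : Fin 2 → 𝓀[F]) ≠ 0 := fun h => by simpa using congrFun h 1
  have h1t : ∀ t : 𝓀[F], (![1, t] : Fin 2 → 𝓀[F]) ≠ 0 := fun t h => by simpa using congrFun h 0
  rcases eq_mk_or_exists_eq_mk_of_isotropic τ x hx h01 h1t with rfl | ⟨t, ht, rfl⟩
  · -- `w = antidiag(1,1)`
    set gw : GL (Fin 2) F := ⟨!![(0 : F), 1; 1, 0], !![(0 : F), 1; 1, 0], antidiagTwo_mul_antidiagTwo, antidiagTwo_mul_antidiagTwo⟩ with hgw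
    have hU : gw ∈ unitaryGroupOfForm σ !![(0 : F), 1; 1, 0] := by
      rw [mem_unitaryGroupOfForm_iff]
      change ((!![(0 : F), 1; 1, 0] : Matrix (Fin 2) (Fin 2) F).map σ)ᵀ * !![(0 : F), 1; 1, 0] * !![(0 : F), 1; 1, 0] = !![(0 : F), 1; 1, 0]
      rw [map_antidiagTwo, Matrix.mul_assoc, antidiagTwo_mul_antidiagTwo, Matrix.mul_one]
      ext i j; fin_cases i <;> fin_cases j <;> rfl
    have hK : gw ∈ glInt 2 F := by
      rw [mem_glInt_iff]
      have h : ∀ i j : Fin 2, (!![(0 : F), 1; 1, 0] : Matrix (Fin 2) (Fin 2) F) i j ∈ 𝒪[F] := by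
        intro i j; fin_cases i <;> fin_cases j
        · exact zero_mem _
        · exact one_mem _
        · exact one_mem _
        · exact zero_mem _
      exact ⟨h, h⟩
    refine ⟨⟨⟨gw, hU⟩, hK⟩, ?_⟩
    rw [Projectivization.smul_mk]
    refine (Projectivization.mk_eq_mk_iff' 𝓀[F] _ _ _ h01).2 ⟨1, ?_⟩
    rw [one_smul]
    change ![0, 1] = ((glIntReduction 2 F ⟨gw, hK⟩ : GL (Fin 2) 𝓀[F]) : Matrix (Fin 2) (Fin 2) 𝓀[F]) *ᵥ ![1, 0]
    rw [mulVec_vecTwo_one_zero, coe_glIntReduction_apply, coe_glIntReduction_apply]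
    have e0 : (⟨((gw : GL (Fin 2) F) : Matrix (Fin 2) (Fin 2) F) 0 0, apply_mem_integer_of_mem_glInt hK 0 0⟩ : 𝒪[F]) = 0 := Subtype.ext rfl
    have e1 : (⟨((gw : GL (Fin 2) F) : Matrix (Fin 2) (Fin 2) F) 1 0, apply_mem_integer_of_mem_glInt hK 1 0⟩ : 𝒪[F]) = 1 := Subtype.ext rfl
    rw [e0, e1, map_zero, map_one]
  · -- `v(s)`, `σ s = −s`, `s ≡ t`
    obtain ⟨s, hst, hσs⟩ := exists_residue_eq_and_map_eq_neg σO τ hτ hσσ ha₀ ht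
    have hσs' : σ (s : F) = -(s : F) := by rw [← hσO', hσs]; rfl
    set gv : GL (Fin 2) F := ⟨!![(1 : F), 0; (s : F), 1], !![(1 : F), 0; -(s : F), 1], (lowerUnipotent_mul_neg (s : F)).1,
      (lowerUnipotent_mul_neg (s : F)).2⟩ with hgv
    have hU : gv ∈ unitaryGroupOfForm σ !![(0 : F), 1; 1, 0] := by
      rw [mem_unitaryGroupOfForm_iff]
      change ((!![(1 : F), 0; (s : F), 1] : Matrix (Fin 2) (Fin 2) F).map σ)ᵀ * !![(0 : F), 1; 1, 0] * !![(1 : F), 0; (s : F), 1] = !![(0 : F), 1; 1, 0]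
      ext i j; fin_cases i <;> fin_cases j <;> simp [Matrix.mul_apply, Fin.sum_univ_two, hσs']
    have hK : gv ∈ glInt 2 F := by
      rw [mem_glInt_iff]
      constructor
      · intro i j; fin_cases i <;> fin_cases j
        · exact one_mem _
        · exact zero_mem _
        · exact s.2
        · exact one_mem _
      · intro i j; fin_cases i <;> fin_cases j
        · exact one_mem _
        · exact zero_mem _
        · exact neg_mem s.2
        · exact one_mem _
    refine ⟨⟨⟨gv, hU⟩, hK⟩, ?_⟩
    rw [Projectivization.smul_mk]
    refine (Projectivization.mk_eq_mk_iff' 𝓀[F] _ _ _ (h1t t)).2 ⟨1, ?_⟩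
    rw [one_smul]
    change ![1, t] = ((glIntReduction 2 F ⟨gv, hK⟩ : GL (Fin 2) 𝓀[F]) : Matrix (Fin 2) (Fin 2) 𝓀[F]) *ᵥ ![1, 0]
    rw [mulVec_vecTwo_one_zero, coe_glIntReduction_apply, coe_glIntReduction_apply]
    have e0 : (⟨((gv : GL (Fin 2) F) : Matrix (Fin 2) (Fin 2) F) 0 0, apply_mem_integer_of_mem_glInt hK 0 0⟩ : 𝒪[F]) = 1 := Subtype.ext rfl
    have e1 : (⟨((gv : GL (Fin 2) F) : Matrix (Fin 2) (Fin 2) F) 1 0, apply_mem_integer_of_mem_glInt hK 1 0⟩ : 𝒪[F]) = s := Subtype.ext rfl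
    rw [e0, e1, map_one, hst]

end Valued

/-! ## §4 The three fixed-point counts on the star `K ⧸ I`, and `[K : I] = q + 1` -/

section Star

variable {F : Type*} [Field F] [ValuativeRel F] (σ : F →+* F) (σO : 𝒪[F] →+* 𝒪[F])
  (hσO' : ∀ x : 𝒪[F], ((σO x : 𝒪[F]) : F) = σ x) (hσσ : ∀ x, σO (σO x) = x) {a₀ : 𝒪[F]} (ha₀ : IsUnit (σO a₀ - a₀))
  (τ : 𝓀[F] →+* 𝓀[F]) (hτ : ∀ x : 𝒪[F], IsLocalRing.residue 𝒪[F] (σO x) = τ (IsLocalRing.residue 𝒪[F] x))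

include hσO' hσσ ha₀ hτ in
/-- **THE STAR DICTIONARY**: for `k ∈ K = U(σ,Φ₂) ∩ GL₂(𝒪)`, the `k`-fixed points of the star `K ⧸ I` (`I = U ∩ Iwahori`) are in bijection with the
`k̄`-fixed ISOTROPIC points of `ℙ(𝓀²)` (★ `natCard_fixedBy_quotient_stabilizer_eq` for the reduction action, `I = Stab ⟨ē₀⟩`, orbit = isotropic points).
[cite: Serre1980Trees, Ch. II §1.1] [cite: Kottwitz1988, §2] -/
theorem natCard_fixedBy_unitaryTwo_star_eq {J : Matrix (Fin 2) (Fin 2) F} (hJ : J = !![0, 1; 1, 0])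
    (k : ↥((glInt 2 F).subgroupOf (unitaryGroupOfForm σ J))) :
    Nat.card (@MulAction.fixedBy _ (↥((glInt 2 F).subgroupOf (unitaryGroupOfForm σ J)) ⧸
        ((iwahoriGL 2 F).subgroupOf (unitaryGroupOfForm σ J)).subgroupOf ((glInt 2 F).subgroupOf (unitaryGroupOfForm σ J))) _
        (MulAction.quotient _ _) k) =
      Nat.card {x : Projectivization 𝓀[F] (Fin 2 → 𝓀[F]) // ((τ ∘ x.rep) ᵥ* !![(0 : 𝓀[F]), 1; 1, 0]) ⬝ᵥ x.rep = 0 ∧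
        (glIntReduction 2 F ⟨((k : ↥(unitaryGroupOfForm σ J)) : GL (Fin 2) F), k.2⟩ : GL (Fin 2) 𝓀[F]) • x = x} := by
  have h10 : (![1, 0] : Fin 2 → 𝓀[F]) ≠ 0 := fun h => by simpa using congrFun h 0
  -- the reduction action of `K` on `ℙ(𝓀²)`
  let ρ : ↥((glInt 2 F).subgroupOf (unitaryGroupOfForm σ J)) →* GL (Fin 2) 𝓀[F] :=
    { toFun := fun k => glIntReduction 2 F ⟨((k : ↥(unitaryGroupOfForm σ J)) : GL (Fin 2) F), k.2⟩
      map_one' := by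
        have h : (⟨(((1 : ↥((glInt 2 F).subgroupOf (unitaryGroupOfForm σ J))) : ↥(unitaryGroupOfForm σ J)) : GL (Fin 2) F),
            (1 : ↥((glInt 2 F).subgroupOf (unitaryGroupOfForm σ J))).2⟩ : ↥(glInt 2 F)) = 1 := Subtype.ext rfl
        rw [h, map_one]
      map_mul' := fun k k' => by
        have h : (⟨(((k * k' : ↥((glInt 2 F).subgroupOf (unitaryGroupOfForm σ J))) : ↥(unitaryGroupOfForm σ J)) : GL (Fin 2) F),
            (k * k').2⟩ : ↥(glInt 2 F)) =
            ⟨((k : ↥(unitaryGroupOfForm σ J)) : GL (Fin 2) F), k.2⟩ * ⟨((k' : ↥(unitaryGroupOfForm σ J)) : GL (Fin 2) F), k'.2⟩ := Subtype.ext rfl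
        rw [h, map_mul] }
  letI : MulAction (↥((glInt 2 F).subgroupOf (unitaryGroupOfForm σ J))) (Projectivization 𝓀[F] (Fin 2 → 𝓀[F])) := MulAction.compHom _ ρ
  have hstab : MulAction.stabilizer (↥((glInt 2 F).subgroupOf (unitaryGroupOfForm σ J))) (Projectivization.mk 𝓀[F] ![1, 0] h10) =
      ((iwahoriGL 2 F).subgroupOf (unitaryGroupOfForm σ J)).subgroupOf ((glInt 2 F).subgroupOf (unitaryGroupOfForm σ J)) := by
    ext k'
    rw [MulAction.mem_stabilizer_iff, mem_iwahori_subgroupOf_iff_smul_eq σ k' h10]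
    rfl
  rw [← hstab, natCard_fixedBy_quotient_stabilizer_eq k (Projectivization.mk 𝓀[F] ![1, 0] h10)]
  have horb : ∀ x : Projectivization 𝓀[F] (Fin 2 → 𝓀[F]),
      x ∈ MulAction.orbit (↥((glInt 2 F).subgroupOf (unitaryGroupOfForm σ J))) (Projectivization.mk 𝓀[F] ![1, 0] h10) ↔
        ((τ ∘ x.rep) ᵥ* !![(0 : 𝓀[F]), 1; 1, 0]) ⬝ᵥ x.rep = 0 := by
    intro x
    constructor
    · rintro ⟨k', rfl⟩
      exact isotropic_glIntReduction_smul σ σO hσO' τ hτ hJ k' h10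
    · intro hx
      obtain ⟨k', hk'⟩ := exists_glIntReduction_smul_eq_of_isotropic σ σO hσO' τ hτ hσσ ha₀ hJ h10 x hx
      exact ⟨k', hk'⟩
  refine Nat.card_congr ((Equiv.subtypeSubtypeEquivSubtypeInter
    (fun x => x ∈ MulAction.orbit (↥((glInt 2 F).subgroupOf (unitaryGroupOfForm σ J))) (Projectivization.mk 𝓀[F] ![1, 0] h10))
    (fun x => k • x = x)).trans (Equiv.subtypeEquivRight fun x => ?_))
  rw [horb]
  rfl

/-- Entries of `a • 1` (`a ∈ 𝒪`) are integral. [cite: IwahoriMatsumoto1965, §2] -/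
theorem smul_one_apply_mem_integer (a : 𝒪[F]) (i j : Fin 2) : ((a : F) • (1 : Matrix (Fin 2) (Fin 2) F)) i j ∈ 𝒪[F] := by
  rw [Matrix.smul_apply, one_apply, smul_eq_mul]
  split_ifs
  · rw [mul_one]; exact a.2
  · rw [mul_zero]; exact zero_mem _

/-- **`k̄` is the scalar `ā` iff `k ≡ a · 1 (mod 𝓂)` entrywise.** [cite: IwahoriMatsumoto1965, §2] -/
theorem coe_glIntReduction_eq_smul_one_iff {J : Matrix (Fin 2) (Fin 2) F} (k : ↥((glInt 2 F).subgroupOf (unitaryGroupOfForm σ J))) (a : 𝒪[F]) :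
    ((glIntReduction 2 F ⟨((k : ↥(unitaryGroupOfForm σ J)) : GL (Fin 2) F), k.2⟩ : GL (Fin 2) 𝓀[F]) : Matrix (Fin 2) (Fin 2) 𝓀[F]) =
        IsLocalRing.residue 𝒪[F] a • (1 : Matrix (Fin 2) (Fin 2) 𝓀[F]) ↔
      ∀ i j, valuation F ((((k : ↥(unitaryGroupOfForm σ J)) : GL (Fin 2) F) : Matrix (Fin 2) (Fin 2) F) i j -
        ((a : F) • (1 : Matrix (Fin 2) (Fin 2) F)) i j) < 1 := by
  -- entry `(i, j)` of both sides, as residues of integers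
  have key : ∀ i j : Fin 2, (((glIntReduction 2 F ⟨((k : ↥(unitaryGroupOfForm σ J)) : GL (Fin 2) F), k.2⟩ : GL (Fin 2) 𝓀[F]) :
      Matrix (Fin 2) (Fin 2) 𝓀[F]) i j = (IsLocalRing.residue 𝒪[F] a • (1 : Matrix (Fin 2) (Fin 2) 𝓀[F])) i j ↔
      valuation F ((((k : ↥(unitaryGroupOfForm σ J)) : GL (Fin 2) F) : Matrix (Fin 2) (Fin 2) F) i j - ((a : F) • (1 : Matrix (Fin 2) (Fin 2) F)) i j) < 1) := by
    intro i j
    rw [← residue_eq_zero_iff_valuation_lt_one ⟨_, sub_mem (apply_mem_integer_of_mem_subgroupOf σ k i j) (smul_one_apply_mem_integer a i j)⟩]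
    have h : (⟨_, sub_mem (apply_mem_integer_of_mem_subgroupOf σ k i j) (smul_one_apply_mem_integer a i j)⟩ : 𝒪[F]) =
        (⟨(((k : ↥(unitaryGroupOfForm σ J)) : GL (Fin 2) F) : Matrix (Fin 2) (Fin 2) F) i j, apply_mem_integer_of_mem_subgroupOf σ k i j⟩ : 𝒪[F]) -
          a * (1 : Matrix (Fin 2) (Fin 2) 𝒪[F]) i j := by
      apply Subtype.ext
      simp only [Matrix.smul_apply, one_apply, smul_eq_mul]
      split_ifs <;> rfl
    rw [h, map_sub, map_mul, sub_eq_zero, coe_glIntReduction_apply, Matrix.smul_apply, smul_eq_mul, one_apply, one_apply]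
    split_ifs with hij
    · rw [map_one]
    · rw [map_zero]
  constructor
  · intro h i j
    exact (key i j).1 (by rw [h])
  · intro h
    ext i j
    exact (key i j).2 (h i j)

include hσO' hσσ ha₀ hτ in
/-- **SCALAR REDUCTION ⇒ `q + 1` FIXED POINTS ON THE STAR**: if `k ≡ a · 1 (mod 𝓂)` then `k` fixes every point of `K ⧸ I`, whose cardinality is the
number `#{t ∈ 𝓀 : τ t = −t} + 1` of isotropic points of `ℙ(𝓀²)`. [cite: Kottwitz1988, §2] [cite: Serre1980Trees, Ch. II §1.1] -/
theorem natCard_fixedBy_unitaryTwo_star_of_scalar [Finite 𝓀[F]] {J : Matrix (Fin 2) (Fin 2) F} (hJ : J = !![0, 1; 1, 0])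
    (k : ↥((glInt 2 F).subgroupOf (unitaryGroupOfForm σ J))) {a : 𝒪[F]}
    (hk : ∀ i j, valuation F ((((k : ↥(unitaryGroupOfForm σ J)) : GL (Fin 2) F) : Matrix (Fin 2) (Fin 2) F) i j -
      ((a : F) • (1 : Matrix (Fin 2) (Fin 2) F)) i j) < 1) :
    Nat.card (@MulAction.fixedBy _ (↥((glInt 2 F).subgroupOf (unitaryGroupOfForm σ J)) ⧸
        ((iwahoriGL 2 F).subgroupOf (unitaryGroupOfForm σ J)).subgroupOf ((glInt 2 F).subgroupOf (unitaryGroupOfForm σ J))) _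
        (MulAction.quotient _ _) k) = Nat.card {t : 𝓀[F] // τ t = -t} + 1 := by
  rw [natCard_fixedBy_unitaryTwo_star_eq σ σO hσO' hσσ ha₀ τ hτ hJ k]
  exact natCard_isotropic_fixed_of_coe_eq_smul_one τ _ ((coe_glIntReduction_eq_smul_one_iff σ k a).2 hk)

include hσO' hσσ ha₀ hτ in
/-- **`[K : I] = #{t ∈ 𝓀 : τ t = −t} + 1`** (`= q + 1`): the star of a hyperspecial vertex of the tree of `U(1,1)` has `q + 1` edges.
[cite: Serre1980Trees, Ch. II §1.1] [cite: Kottwitz1988, §2] -/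
theorem natCard_unitaryTwo_star [Finite 𝓀[F]] {J : Matrix (Fin 2) (Fin 2) F} (hJ : J = !![0, 1; 1, 0]) :
    Nat.card (↥((glInt 2 F).subgroupOf (unitaryGroupOfForm σ J)) ⧸
        ((iwahoriGL 2 F).subgroupOf (unitaryGroupOfForm σ J)).subgroupOf ((glInt 2 F).subgroupOf (unitaryGroupOfForm σ J))) =
      Nat.card {t : 𝓀[F] // τ t = -t} + 1 := by
  letI : MulAction (↥((glInt 2 F).subgroupOf (unitaryGroupOfForm σ J))) (↥((glInt 2 F).subgroupOf (unitaryGroupOfForm σ J)) ⧸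
      ((iwahoriGL 2 F).subgroupOf (unitaryGroupOfForm σ J)).subgroupOf ((glInt 2 F).subgroupOf (unitaryGroupOfForm σ J))) :=
    MulAction.quotient _ _
  rw [← natCard_fixedBy_unitaryTwo_star_of_scalar σ σO hσO' hσσ ha₀ τ hτ hJ 1 (a := 1) (fun i j => by
    rw [OneMemClass.coe_one, OneMemClass.coe_one, Units.val_one, OneMemClass.coe_one, one_smul, sub_self, map_zero]; exact zero_lt_one)]
  refine Nat.card_congr ((Equiv.Set.univ _).symm.trans (Equiv.setCongr ?_))
  ext x
  simp only [Set.mem_univ, MulAction.mem_fixedBy, one_smul]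

include hσO' hσσ ha₀ hτ in
/-- **DOUBLE EIGENVALUE, NON-SCALAR ⇒ ONE FIXED POINT ON THE STAR** (the elliptic `γ` at a vertex at distance `N` from its fixed locus):
`k = P diag(u₀, u₁) P⁻¹ ∈ K` with `u₀, u₁` integral of norm one, `|u₀ − u₁| < 1`, `k ≢ u₁ · 1 (mod 𝓂)` ⇒ exactly one point of `K ⧸ I` is
`k`-fixed. [cite: Kottwitz1988, §2] [cite: Rogawski1990, §12.6 p. 174] -/
theorem natCard_fixedBy_unitaryTwo_star_of_valuation_sub_lt_one [Finite 𝓀[F]] {J : Matrix (Fin 2) (Fin 2) F} (hJ : J = !![0, 1; 1, 0])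
    (k : ↥((glInt 2 F).subgroupOf (unitaryGroupOfForm σ J))) {P : GL (Fin 2) F} {u : Fin 2 → F}
    (hP : (((k : ↥(unitaryGroupOfForm σ J)) : GL (Fin 2) F) : Matrix (Fin 2) (Fin 2) F) * P = P * diagonal u) (hu : ∀ i, u i ∈ 𝒪[F])
    (hu1 : ∀ i, σ (u i) * u i = 1) (hN : valuation F (u 0 - u 1) < 1)
    (hns : ¬ ∀ i j, valuation F ((((k : ↥(unitaryGroupOfForm σ J)) : GL (Fin 2) F) : Matrix (Fin 2) (Fin 2) F) i j -
      (u 1 • (1 : Matrix (Fin 2) (Fin 2) F)) i j) < 1) :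
    Nat.card (@MulAction.fixedBy _ (↥((glInt 2 F).subgroupOf (unitaryGroupOfForm σ J)) ⧸
        ((iwahoriGL 2 F).subgroupOf (unitaryGroupOfForm σ J)).subgroupOf ((glInt 2 F).subgroupOf (unitaryGroupOfForm σ J))) _
        (MulAction.quotient _ _) k) = 1 := by
  rw [natCard_fixedBy_unitaryTwo_star_eq σ σO hσO' hσσ ha₀ τ hτ hJ k]
  have hM := transpose_map_glIntReduction_mul_antidiagTwo_mul σ σO hσO' τ hτ hJ k
  obtain ⟨htr, hdet⟩ := trace_det_glIntReduction_of_eigenframe σ k hP hu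
  -- `ū₀ = ū₁ =: λ`, `τλ λ = 1`
  have h01 : IsLocalRing.residue 𝒪[F] ⟨u 0, hu 0⟩ = IsLocalRing.residue 𝒪[F] ⟨u 1, hu 1⟩ := by
    rw [← sub_eq_zero, ← map_sub, residue_eq_zero_iff_valuation_lt_one]
    exact hN
  have hl : τ (IsLocalRing.residue 𝒪[F] ⟨u 1, hu 1⟩) * IsLocalRing.residue 𝒪[F] ⟨u 1, hu 1⟩ = 1 := by
    rw [← hτ, ← map_mul, ← map_one (IsLocalRing.residue 𝒪[F])]
    congr 1
    apply Subtype.ext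
    rw [Subring.coe_mul, hσO', OneMemClass.coe_one]
    exact hu1 1
  rw [h01] at htr hdet
  refine natCard_isotropic_fixed_eq_one_of_sq_eq_zero τ _ hM (sub_smul_one_mul_self_eq_zero htr hdet) (fun h => hns ?_) hl
  exact (coe_glIntReduction_eq_smul_one_iff σ k ⟨u 1, hu 1⟩).1 h

include hσO' hσσ ha₀ hτ in
/-- **TWO DISTINCT NORM-ONE EIGENVALUES MOD `𝓂` ⇒ NO FIXED POINT ON THE STAR** (the elliptic `γ` with `|u₀ − u₁| = 1`, or any vertex where `γ̄`
is regular semisimple with norm-one eigenvalues): `k = P diag(u₀, u₁) P⁻¹ ∈ K`, `uᵢ` integral of norm one, `|u₀ − u₁| = 1` ⇒ no point of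
`K ⧸ I` is `k`-fixed. [cite: Kottwitz1988, §2] [cite: Rogawski1990, §12.6 p. 174] -/
theorem natCard_fixedBy_unitaryTwo_star_of_valuation_sub_eq_one [Finite 𝓀[F]] {J : Matrix (Fin 2) (Fin 2) F} (hJ : J = !![0, 1; 1, 0])
    (k : ↥((glInt 2 F).subgroupOf (unitaryGroupOfForm σ J))) {P : GL (Fin 2) F} {u : Fin 2 → F}
    (hP : (((k : ↥(unitaryGroupOfForm σ J)) : GL (Fin 2) F) : Matrix (Fin 2) (Fin 2) F) * P = P * diagonal u) (hu : ∀ i, u i ∈ 𝒪[F])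
    (hu1 : ∀ i, σ (u i) * u i = 1) (hN : valuation F (u 0 - u 1) = 1) :
    Nat.card (@MulAction.fixedBy _ (↥((glInt 2 F).subgroupOf (unitaryGroupOfForm σ J)) ⧸
        ((iwahoriGL 2 F).subgroupOf (unitaryGroupOfForm σ J)).subgroupOf ((glInt 2 F).subgroupOf (unitaryGroupOfForm σ J))) _
        (MulAction.quotient _ _) k) = 0 := by
  rw [natCard_fixedBy_unitaryTwo_star_eq σ σO hσO' hσσ ha₀ τ hτ hJ k]
  have hM := transpose_map_glIntReduction_mul_antidiagTwo_mul σ σO hσO' τ hτ hJ k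
  obtain ⟨htr, hdet⟩ := trace_det_glIntReduction_of_eigenframe σ k hP hu
  set M : Matrix (Fin 2) (Fin 2) 𝓀[F] := ((glIntReduction 2 F ⟨((k : ↥(unitaryGroupOfForm σ J)) : GL (Fin 2) F), k.2⟩ : GL (Fin 2) 𝓀[F]) :
    Matrix (Fin 2) (Fin 2) 𝓀[F]) with hMdef
  have hne : IsLocalRing.residue 𝒪[F] ⟨u 0, hu 0⟩ ≠ IsLocalRing.residue 𝒪[F] ⟨u 1, hu 1⟩ := by
    rw [Ne, ← sub_eq_zero, ← map_sub, residue_eq_zero_iff_valuation_lt_one]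
    exact fun h => (lt_irrefl (1 : ValueGroupWithZero F)) (hN ▸ h :)
  have hnorm : ∀ i, τ (IsLocalRing.residue 𝒪[F] ⟨u i, hu i⟩) * IsLocalRing.residue 𝒪[F] ⟨u i, hu i⟩ = 1 := by
    intro i
    rw [← hτ, ← map_mul, ← map_one (IsLocalRing.residue 𝒪[F])]
    congr 1
    apply Subtype.ext
    rw [Subring.coe_mul, hσO', OneMemClass.coe_one]
    exact hu1 i
  -- eigenvectors of `M` for `ū₀`, `ū₁`
  have heig : ∀ i, ∃ v : Fin 2 → 𝓀[F], v ≠ 0 ∧ M *ᵥ v = IsLocalRing.residue 𝒪[F] ⟨u i, hu i⟩ • v := by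
    intro i
    have hdet0 : (M - IsLocalRing.residue 𝒪[F] ⟨u i, hu i⟩ • (1 : Matrix (Fin 2) (Fin 2) 𝓀[F])).det = 0 := by
      rw [det_fin_two]
      simp only [Matrix.sub_apply, Matrix.smul_apply, one_apply_eq, one_apply_ne (show (0 : Fin 2) ≠ 1 by decide),
        one_apply_ne (show (1 : Fin 2) ≠ 0 by decide), smul_eq_mul, mul_one, mul_zero, sub_zero]
      have hi : (IsLocalRing.residue 𝒪[F] ⟨u i, hu i⟩ - IsLocalRing.residue 𝒪[F] ⟨u 0, hu 0⟩) *
          (IsLocalRing.residue 𝒪[F] ⟨u i, hu i⟩ - IsLocalRing.residue 𝒪[F] ⟨u 1, hu 1⟩) = 0 := by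
        fin_cases i <;> simp
      linear_combination hdet - (IsLocalRing.residue 𝒪[F] ⟨u i, hu i⟩) * htr + hi
    obtain ⟨v, hv0, hv⟩ := Matrix.exists_mulVec_eq_zero_iff.2 hdet0
    refine ⟨v, hv0, ?_⟩
    rwa [sub_mulVec, smul_mulVec, one_mulVec, sub_eq_zero] at hv
  obtain ⟨v, hv0, hv⟩ := heig 0
  obtain ⟨w, hw0, hw⟩ := heig 1
  exact natCard_isotropic_fixed_eq_zero_of_eigenpair τ _ hM hv hw hv0 hw0 hne (hnorm 0) (hnorm 1)

include hσσ ha₀ hτ in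
/-- **`#{t ∈ 𝓀 : τ t = −t} = q`** when `|𝓀| = q²` and `σ` moves an integer by a unit (★ `natCard_antifixed_quotient_pow` at level `1`, read on
`𝓀 = 𝒪 ∕ 𝓂`). [cite: Serre1979, Ch. V §2 Prop. 2–3] -/
theorem natCard_antifixed_residueField_eq [IsDiscreteValuationRing 𝒪[F]] {q : ℕ} (hq : Nat.card 𝓀[F] = q ^ 2) :
    Nat.card {t : 𝓀[F] // τ t = -t} = q := by
  have h := LocalFields.UnramifiedQuadraticNorm.natCard_antifixed_quotient_pow σO hσσ ha₀ hq 1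
  rw [pow_one q] at h
  rw [← h]
  symm
  refine Nat.card_congr ((Ideal.quotEquivOfEq (pow_one (IsLocalRing.maximalIdeal 𝒪[F]))).toEquiv.subtypeEquiv fun x => ?_)
  induction x using Quotient.inductionOn' with
  | h y =>
    change Ideal.quotientMap _ σO _ (Ideal.Quotient.mk _ y) = -Ideal.Quotient.mk _ y ↔
      τ (Ideal.quotEquivOfEq _ (Ideal.Quotient.mk _ y)) = -Ideal.quotEquivOfEq _ (Ideal.Quotient.mk _ y)
    rw [Ideal.quotientMap_mk, Ideal.quotEquivOfEq_mk, ← map_neg (Ideal.Quotient.mk (IsLocalRing.maximalIdeal 𝒪[F] ^ 1)), Ideal.Quotient.eq,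
      pow_one]
    change _ ↔ τ (IsLocalRing.residue 𝒪[F] y) = -IsLocalRing.residue 𝒪[F] y
    rw [← hτ, ← map_neg (IsLocalRing.residue 𝒪[F])]
    exact Ideal.Quotient.eq.symm

end Star

end Literature.NumberTheory.Automorphic
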